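import Literature.NumberTheory.Sieve.MatomakiRadziwillTheorem1Khale
import Literature.NumberTheory.LFunctions.TwistedPrimeSumTail
import Literature.NumberTheory.LFunctions.VinogradovKorobovFromRichert
import HarnessLib

/-!
# Matomäki–Radziwiłł 2016, Lemma 3 and Proposition 1 without Ford's bound: the Vinogradov–Korobov prime tail suffices

Topic `Literature/NumberTheory/Sieve`.  Everything in this file is PROVED; no definitions of facts, no new
named facts.  It removes Ford's explicit Richert-type bound `zeta_bound_ford` (Ford 2002, Thm 1, the constants
`76.2`, `4.45`) from the trust base of Proposition 1 / Theorem 1 of K. Matomäki, M. Radziwiłł, *Multiplicative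
functions in short intervals*, Ann. of Math. 183 (2016):

* `MatomakiRadziwill2016_prop1_of_khale : Khale2024_zeroFreeRegion → MatomakiRadziwill2016_prop1`

(before: `MatomakiRadziwill2016_prop1_of_ford_khale : zeta_bound_ford → Khale2024_zeroFreeRegion → …`,
`MatomakiRadziwillTheorem1Khale.lean`), and likewise `MatomakiRadziwill2016_theorem3/theorem1_of_lemma4_khale`,
`matomaki_radziwill_of_lemma4_khale`.

## The point

In the tree, Ford's bound enters Proposition 1 only through MR's Lemma 2 in the sharp form
`𝔻(1, n^{iτ}; x)² ≥ (1/3) log log x − C_A` (`2 ≤ |τ| ≤ x^A`; `PretentiousFord.pretentiousDistSq_one_twist_ge`,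
from `|ζ(1 + it)| ≪ (log t)^{2/3}`), consumed by the first part of the proof of Lemma 3
(`MatomakiRadziwillL3.first_part_numeric`).  The printed Lemma 2 has `(1/3 − ε)` and is proved from "the
zero-free region for the Riemann zeta-function", i.e. from
`|∑_{exp((log x)^{2/3+ε}) ≤ p ≤ x} p^{-1-2iα}| = O(1)` — which the tree HAS, from Khale's Vinogradov–Korobov
region, as `TwistedPrimeSumTail.pretentiousDistSq_one_twist_tail_ge` (any `θ > 2/3`:
`𝔻(1, n^{it}; Y)² − 𝔻(1, n^{it}; e^{(log X)^θ} − 1)² ≥ log log Y − θ log log X − 6` for `1 ≤ |t| ≤ X`,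
`e^{(log X)^θ} ≤ Y ≤ X`, `X` large).  The printed proof of Lemma 3 has room for the `ε`: the Halász saving is
`exp(−(39/40) M₀)` with `M₀ = ¼ (c log log Y_* − C_D) + ½ Σ_S(Y_*)`, i.e. `(log X)^{−(39/160) c}`, and Lemma 3
asks for `(log X)^{−1/16}`; so any `c ≥ 10/39` works, not only `c = 1/3` (`(39/160)/3 = 13/160`).  We take
`θ = 7/10`, `c = 1 − θ = 3/10` (`(39/160)(3/10) = 117/1600 > 1/16`):

* `MatomakiRadziwillL3VK.pretentiousDistSq_one_twist_ge_of_tail` — the tail bound at `θ = 7/10` gives, for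
  every `A' > 0`, `x₀, C_D` with `𝔻(1, n^{iτ}; x)² ≥ (3/10) log log x − C_D` for `x ≥ x₀`, `2 ≤ |τ| ≤ x^{A'}`
  (applied at the scale `X = x^{max(A',1)}`, `Y = x`; `e^{(log X)^{7/10}} ≤ x` once `log x ≥ max(A',1)^{7/3}`);
* `MatomakiRadziwillL3VK.M0'_le_Msum`, `fibre_bound'`, `first_part_le'`, `termA_le'`,
  `first_part_numeric'` — the first part of the proof of Lemma 3 of `MatomakiRadziwillLemma3.lean`
  (K. Matomäki–M. Radziwiłł §2: Halász on each fibre `n₁ ≤ X^{3/4}`) verbatim with `1/3` replaced by `3/10`;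
  only the exponent bookkeeping of `termA_le'` changes;
* `MatomakiRadziwill2016_lemma3_of_GS_tail` — **Lemma 3** from Granville–Soundararajan's Theorem 1 and the
  tail bound (second part, thresholds and assembly reused from `MatomakiRadziwillLemma3.lean` unchanged);
  `MatomakiRadziwill2016_lemma3_of_khale` — from `Khale2024_zeroFreeRegion` alone
  (`GranvilleSoundararajan2003_theorem1_holds` is proved);
* `MatomakiRadziwill2016_prop1_of_khale` — **Proposition 1** from Khale's region alone, through
  `MatomakiRadziwill2016_prop1_of_lemma3_lemma11` and `MatomakiRadziwill2016_lemma11_of_khale`; and the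
  Theorem 3 / Theorem 1 / parity.S38 chain from Lemma 4 and Khale;
* `MatomakiRadziwill2016_lemma3_of_vk`, `MatomakiRadziwill2016_prop1_of_vk`, `…theorem3/theorem1_of_lemma4_vk`,
  `matomaki_radziwill_of_lemma4_vk` — the same from ANY Vinogradov–Korobov region `HasVKZeroFreeRegion c T₀`
  (`c > 0`; the inexplicit interface of `VinogradovKorobovDirichlet.lean`, through the `…_of_vk` forms of
  `TwistedPrimeSumTail` and `MatomakiRadziwill2016_lemma11_of_vk`);
* `MatomakiRadziwill2016_prop1_of_richert`, `MatomakiRadziwill2016_theorem1_of_lemma4_richert` — the same from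
  Richert-type bounds `RichertBound A B ∧ RichertBoundL A B` (any constants), via `hasVKZeroFreeRegion_of_richert`.

So the discharge `MatomakiRadziwill2016_prop1_holds` now waits on exactly one input, a Vinogradov–Korobov
zero-free region for Dirichlet `L`-functions: the named fact `Khale2024_zeroFreeRegion`, or ANY
`HasVKZeroFreeRegion c T₀` with `c > 0` (explicit or not).

## References
* K. Matomäki, M. Radziwiłł, Ann. of Math. (2) 183 (2016), 1015–1056 (arXiv:1501.04585), §2 Lemmas 2, 3; §8
  Proposition 1. [cite: MatomakiRadziwillAnnals2016, Lemma 3]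
* A. Granville, K. Soundararajan, Canad. J. Math. 55 (2003), Theorem 1. [cite: GranvilleSoundararajan2003, Theorem 1]
* T. Khale, Q. J. Math. 75 (2024), Theorem 1.1. [cite: Khale2024, Theorem 1.1]
-/

noncomputable section

open Finset Real Complex Filter
open Literature.NumberTheory.LFunctions.GranvilleSoundararajan
open Literature.NumberTheory.Sieve.MatomakiRadziwillL4A

namespace Literature.NumberTheory.Sieve

namespace MatomakiRadziwillL3VK

open MatomakiRadziwillL3
open MatomakiRadziwillL13 (sPart sPart_pos sPart_dvd primeFactors_sPart_subset sPart_mem_factoredNumbers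
  dvd_sPart_of_dvd sPart_le)

/-! ### MR Lemma 2 with coefficient `3/10` from the Vinogradov–Korobov prime tail at `θ = 7/10` -/

/-- `(B ℓ)^{7/10} ≤ ℓ` once `ℓ ≥ B^{7/3}` (`B ≥ 1`). [folklore] -/
theorem rpow_seven_tenths_le {B ℓ : ℝ} (hB : 1 ≤ B) (hℓ : B ^ (7 / 3 : ℝ) ≤ ℓ) :
    (B * ℓ) ^ (7 / 10 : ℝ) ≤ ℓ := by
  have hB0 : 0 ≤ B := by linarith
  have hB73 : 1 ≤ B ^ (7 / 3 : ℝ) := Real.one_le_rpow hB (by norm_num)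
  have hℓ0 : 0 ≤ ℓ := by linarith
  rw [Real.mul_rpow hB0 hℓ0]
  have h1 : B ^ (7 / 10 : ℝ) ≤ ℓ ^ (3 / 10 : ℝ) := by
    calc B ^ (7 / 10 : ℝ) = (B ^ (7 / 3 : ℝ)) ^ (3 / 10 : ℝ) := by
          rw [← Real.rpow_mul hB0]; norm_num
      _ ≤ ℓ ^ (3 / 10 : ℝ) := Real.rpow_le_rpow (by positivity) hℓ (by norm_num)
  calc B ^ (7 / 10 : ℝ) * ℓ ^ (7 / 10 : ℝ) ≤ ℓ ^ (3 / 10 : ℝ) * ℓ ^ (7 / 10 : ℝ) :=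
        mul_le_mul_of_nonneg_right h1 (by positivity)
    _ = ℓ := by
        rw [← Real.rpow_add' hℓ0 (by norm_num)]; norm_num

/-- **MR Lemma 2 (for `f = 1`) with the coefficient `3/10`, from the Vinogradov–Korobov prime tail.**  If, for
all large `X`, `𝔻(1, n^{it}; Y)² − 𝔻(1, n^{it}; e^{(log X)^{7/10}} − 1)² ≥ log log Y − (7/10) log log X − 6`
whenever `1 ≤ |t| ≤ X` and `e^{(log X)^{7/10}} ≤ Y ≤ X` (the conclusion of
`TwistedPrimeSumTail.pretentiousDistSq_one_twist_tail_ge` at `θ = 7/10`), then for every real `A'` there are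
`x₀ ≥ 3` and `C_D` with `𝔻(1, n^{iτ}; x)² ≥ (3/10) log log x − C_D` for all `x ≥ x₀`, `2 ≤ |τ| ≤ x^{A'}`
(scale `X = x^{max(A',1)}`, `Y = x`, `C_D = (7/10) log max(A',1) + 6`).
[cite: MatomakiRadziwillAnnals2016, Lemma 2 (proof)] -/
theorem pretentiousDistSq_one_twist_ge_of_tail
    (hT : ∀ᶠ X : ℝ in atTop, ∀ t : ℝ, 1 ≤ |t| → |t| ≤ X → ∀ Y : ℝ,
      Real.exp (Real.log X ^ (7 / 10 : ℝ)) ≤ Y → Y ≤ X →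
        Real.log (Real.log Y) - 7 / 10 * Real.log (Real.log X) - 6 ≤
          pretentiousDistSq 1 (fun n : ℕ => (n : ℂ) ^ ((t : ℂ) * I)) Y -
            pretentiousDistSq 1 (fun n : ℕ => (n : ℂ) ^ ((t : ℂ) * I)) (Real.exp (Real.log X ^ (7 / 10 : ℝ)) - 1))
    (A' : ℝ) :
    ∃ x₀ C_D : ℝ, 3 ≤ x₀ ∧ ∀ x : ℝ, x₀ ≤ x → ∀ τ : ℝ, 2 ≤ |τ| → |τ| ≤ x ^ A' →
      3 / 10 * Real.log (Real.log x) - C_D ≤ pretentiousDistSq 1 (fun n : ℕ => (n : ℂ) ^ ((τ : ℂ) * I)) x := by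
  set B : ℝ := max A' 1 with hBdef
  have hB1 : 1 ≤ B := le_max_right _ _
  have hB0 : 0 < B := by linarith
  have h1 := (tendsto_rpow_atTop hB0).eventually hT
  have h2 : ∀ᶠ x : ℝ in atTop, B ^ (7 / 3 : ℝ) ≤ Real.log x :=
    Real.tendsto_log_atTop.eventually_ge_atTop _
  obtain ⟨x₁, hx₁⟩ := Filter.eventually_atTop.1 (h1.and (h2.and (eventually_ge_atTop (3 : ℝ))))
  refine ⟨max x₁ 3, 7 / 10 * Real.log B + 6, le_max_right _ _, fun x hx τ hτ2 hτA => ?_⟩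
  obtain ⟨hX, hlog, hx3⟩ := hx₁ x ((le_max_left _ _).trans hx)
  have hx0 : 0 < x := by linarith
  have hx1 : 1 ≤ x := by linarith
  have hℓ : 0 < Real.log x := Real.log_pos (by linarith)
  have hτB : |τ| ≤ x ^ B := hτA.trans (Real.rpow_le_rpow_of_exponent_le hx1 (le_max_left _ _))
  have hτ1 : 1 ≤ |τ| := by linarith
  have hlogXB : Real.log (x ^ B) = B * Real.log x := Real.log_rpow hx0 B
  have hkey : Real.exp (Real.log (x ^ B) ^ (7 / 10 : ℝ)) ≤ x := by
    rw [hlogXB]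
    calc Real.exp ((B * Real.log x) ^ (7 / 10 : ℝ)) ≤ Real.exp (Real.log x) :=
          Real.exp_le_exp.2 (rpow_seven_tenths_le hB1 hlog)
      _ = x := Real.exp_log hx0
  have hxX : x ≤ x ^ B := by
    calc x = x ^ (1 : ℝ) := (Real.rpow_one x).symm
      _ ≤ x ^ B := Real.rpow_le_rpow_of_exponent_le hx1 hB1
  have hmain := hX τ hτ1 hτB x hkey hxX
  have hnn := pretentiousDistSq_nonneg (f := (1 : ℕ → ℂ)) (g := fun n : ℕ => (n : ℂ) ^ ((τ : ℂ) * I))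
    (fun n => by simp) (fun n => norm_natCast_cpow_mul_I n _) (Real.exp (Real.log (x ^ B) ^ (7 / 10 : ℝ)) - 1)
  have hll : Real.log (Real.log (x ^ B)) = Real.log B + Real.log (Real.log x) := by
    rw [hlogXB, Real.log_mul hB0.ne' hℓ.ne']
  rw [hll] at hmain
  linarith

/-! ### The first part of Lemma 3 with the coefficient `3/10` (copied from `MatomakiRadziwillLemma3.lean`) -/

-- `M₀' = ¼ ((3/10) log log Y_* − C_D) + ½ Σ_S(Y_*)` is kept inline below (no auxiliary definition).

/-- The distance of the sifted twist on a fibre is at least `M₀'` (coefficient `3/10`): monotonicity in the height down to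
`Y_*`, `Msum_siftedTwist_ge`, and the `3/10`-distance bound (`hD`) at `τ = 2(t + y)`, `|y| ≤ t/2`. [folklore] -/
theorem M0'_le_Msum {A' x₀ C_D : ℝ}
    (hD : ∀ x : ℝ, x₀ ≤ x → ∀ τ : ℝ, 2 ≤ |τ| → |τ| ≤ x ^ A' →
      3 / 10 * Real.log (Real.log x) - C_D ≤ pretentiousDistSq 1 (fun n : ℕ => (n : ℂ) ^ ((τ : ℂ) * I)) x)
    {f : ArithmeticFunction ℝ} (hf1 : ∀ n, |f n| ≤ 1) {S : Finset ℕ} (hS : ∀ p ∈ S, p.Prime)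
    {X t A : ℝ} (hX1 : 1 ≤ X) (hYx₀ : x₀ ≤ Ystar X)
    (hXA : 3 * X ^ A ≤ (Ystar X) ^ A') (ht4 : 4 ≤ t) (htA : t ≤ X ^ A) (ht0A : 0 ≤ A)
    {Y : ℝ} (hY : Ystar X ≤ Y) {y : ℝ} (hy : |y| ≤ 2 * (t / 4)) :
    ((1 / 4) * (3 / 10 * Real.log (Real.log (Ystar X)) - C_D) + (1 / 2) * Sig S (Ystar X)) ≤ Msum (siftedTwist f S t) Y y := by
  have h1 := Msum_siftedTwist_ge hf1 hS Y t y
  refine le_trans ?_ h1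
  have hmonoD : pretentiousDistSq 1 (fun n : ℕ => (n : ℂ) ^ (((2 * (t + y) : ℝ) : ℂ) * I)) (Ystar X) ≤
      pretentiousDistSq 1 (fun n : ℕ => (n : ℂ) ^ (((2 * (t + y) : ℝ) : ℂ) * I)) Y :=
    pretentiousDistSq_mono (fun n => by simp) (fun n => norm_natCast_cpow_mul_I n _) hY
  have hmonoS : Sig S (Ystar X) ≤ ∑ p ∈ (Nat.primesLE ⌊Y⌋₊).filter (· ∈ S), (1 : ℝ) / p := Sig_mono S hY
  have hτ1 : 2 ≤ |2 * (t + y)| := by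
    rw [abs_mul, abs_two]
    have : t / 2 ≤ |t + y| := by
      have := abs_le.1 hy
      rw [le_abs]; left; linarith
    linarith
  have hτ2 : |2 * (t + y)| ≤ (Ystar X) ^ A' := by
    have : |2 * (t + y)| ≤ 3 * t := by
      rw [abs_le]; have := abs_le.1 hy; constructor <;> linarith
    have hXA' : X ^ A ≥ 1 := Real.one_le_rpow hX1 ht0A
    nlinarith
  have h2 := hD (Ystar X) hYx₀ (2 * (t + y)) hτ1 hτ2
  linarith

set_option maxHeartbeats 400000 in
/-- **The Halász bound on one fibre** (uniform in `n₁ ≤ X^{3/4}`): with the constants of `halasz_of_GS`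
and of the `3/10`-distance bound `hD` (exponent `A'`), for `X` large
(`Y_* ≥ x₀`, `Y_* ≥ 4`, `3X^A ≤ Y_*^{A'}`), `4 ≤ t ≤ X^A`, real multiplicative `|f| ≤ 1` and `1 ≤ n₁ ≤ X^{3/4}`:
`‖∑_{a ≤ m ≤ b} G(m)/m‖ ≤ 6 (C_H e^{-(39/40) M₀'} + C_H (4/t + log log (2X) / log Y_*))`.
[cite: MatomakiRadziwillAnnals2016, Lemma 3 (proof: "apply Halász's theorem (Lemmas 1 and 2) to the sum over n₂")] -/
theorem fibre_bound' {C_H : ℝ} (hC_H : 0 ≤ C_H)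
    (hH : ∀ g : ArithmeticFunction ℂ, g.IsMultiplicative → (∀ n, ‖g n‖ ≤ 1) →
      ∀ x T M₀ : ℝ, 3 ≤ x → 1 ≤ T → (∀ y : ℝ, |y| ≤ 2 * T → M₀ ≤ Msum g x y) →
        ‖∑ n ∈ Icc 1 ⌊x⌋₊, g n‖ ≤
          x * (C_H * Real.exp (-(39 / 40) * M₀) + C_H * (1 / T + Real.log (Real.log x) / Real.log x)))
    {A' x₀ C_D : ℝ}
    (hD : ∀ x : ℝ, x₀ ≤ x → ∀ τ : ℝ, 2 ≤ |τ| → |τ| ≤ x ^ A' →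
      3 / 10 * Real.log (Real.log x) - C_D ≤ pretentiousDistSq 1 (fun n : ℕ => (n : ℂ) ^ ((τ : ℂ) * I)) x)
    {f : ArithmeticFunction ℝ} (hf : f.IsMultiplicative) (hf1 : ∀ n, |f n| ≤ 1)
    {P Q X t A : ℝ} (hX1 : 1 ≤ X) (hYx₀ : x₀ ≤ Ystar X) (hY4 : 4 ≤ Ystar X)
    (hXA : 3 * X ^ A ≤ (Ystar X) ^ A') (ht4 : 4 ≤ t) (htA : t ≤ X ^ A) (ht0A : 0 ≤ A)
    {n₁ : ℕ} (hn₁ : 1 ≤ n₁) (hn₁Z : (n₁ : ℝ) ≤ X ^ (3 / 4 : ℝ)) :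
    ‖∑ m ∈ Finset.Icc ((⌈X⌉₊ + n₁ - 1) / n₁) (⌊2 * X⌋₊ / n₁), siftedTwist f (primesPQ P Q) t m / m‖ ≤
      6 * (C_H * Real.exp (-(39 / 40) * ((1 / 4) * (3 / 10 * Real.log (Real.log (Ystar X)) - C_D) + (1 / 2) * Sig (primesPQ P Q) (Ystar X))) +
        C_H * (4 / t + Real.log (Real.log (2 * X)) / Real.log (Ystar X))) := by
  set S := primesPQ P Q with hSdef
  have hS : ∀ p ∈ S, p.Prime := primesPQ_prime
  set a : ℕ := (⌈X⌉₊ + n₁ - 1) / n₁ with ha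
  set b : ℕ := ⌊2 * X⌋₊ / n₁ with hb
  have hX0 : 0 < X := by linarith
  have hn0 : (0 : ℝ) < n₁ := by exact_mod_cast hn₁
  obtain ⟨ha_ge, hb_le⟩ := fibre_endpoints hX1 hn₁
  rw [← ha] at ha_ge; rw [← hb] at hb_le
  -- `a ≥ X/n₁ ≥ X^{1/4} = 2 Y_* ≥ 8`
  have hXn : X ^ (1 / 4 : ℝ) ≤ X / n₁ := by
    rw [le_div_iff₀ hn0]
    calc X ^ (1 / 4 : ℝ) * n₁ ≤ X ^ (1 / 4 : ℝ) * X ^ (3 / 4 : ℝ) :=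
          mul_le_mul_of_nonneg_left hn₁Z (by positivity)
      _ = X := by rw [← Real.rpow_add hX0]; norm_num
  have hYdef : Ystar X = X ^ (1 / 4 : ℝ) / 2 := rfl
  have haY : 2 * Ystar X ≤ a := by rw [hYdef]; linarith
  have ha8 : (8 : ℝ) ≤ a := by linarith
  have ha4 : 4 ≤ a := by exact_mod_cast (show (4 : ℝ) ≤ a by linarith)
  have hb2X : (b : ℝ) ≤ 2 * X := hb_le.trans (by
      rw [div_le_iff₀ hn0]; have : (1:ℝ) ≤ n₁ := by exact_mod_cast hn₁
      nlinarith)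
  have hX8 : (8 : ℝ) ≤ X := by
    have h1 : X / n₁ ≤ X := div_le_self hX0.le (by exact_mod_cast hn₁)
    have h2 : 8 ≤ X ^ (1 / 4 : ℝ) := by rw [hYdef] at hY4; linarith
    linarith
  have hll0 : 0 ≤ Real.log (Real.log (2 * X)) / Real.log (Ystar X) := by
    refine div_nonneg (Real.log_nonneg ?_) (Real.log_nonneg (by linarith))
    have h2X : (16 : ℝ) ≤ 2 * X := by linarith
    rw [← Real.log_exp 1]; refine Real.log_le_log (Real.exp_pos 1) ?_
    have := Real.exp_one_lt_d9; norm_num at this; linarith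
  have hRHS0 : 0 ≤ 6 * (C_H * Real.exp (-(39 / 40) * ((1 / 4) * (3 / 10 * Real.log (Real.log (Ystar X)) - C_D) + (1 / 2) * Sig S (Ystar X))) +
      C_H * (4 / t + Real.log (Real.log (2 * X)) / Real.log (Ystar X))) := by positivity
  -- empty fibre
  rcases lt_or_ge b a with hba | hab
  · rw [Finset.Icc_eq_empty (by omega), Finset.sum_empty, norm_zero]; exact hRHS0
  -- Halász + partial summation on the fibre
  have hT : (1 : ℝ) ≤ t / 4 := by rw [le_div_iff₀ (by norm_num)]; linarith
  have ha1Y : Ystar X ≤ ((a - 1 : ℕ) : ℝ) := by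
    have : ((a - 1 : ℕ) : ℝ) = a - 1 := by rw [Nat.cast_sub (by omega)]; simp
    rw [this]; linarith
  have hM : ∀ y : ℝ, |y| ≤ 2 * (t / 4) → ((1 / 4) * (3 / 10 * Real.log (Real.log (Ystar X)) - C_D) + (1 / 2) * Sig S (Ystar X)) ≤ Msum (siftedTwist f S t) ((a - 1 : ℕ) : ℝ) y :=
    fun y hy => M0'_le_Msum hD hf1 hS hX1 hYx₀ hXA ht4 htA ht0A ha1Y hy
  have hmain := norm_sum_Icc_div_le hC_H hH (isMultiplicative_siftedTwist hf hS t)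
    (norm_siftedTwist_le hf1 S t) ha4 hab hT hM
  refine hmain.trans ?_
  have hb8 : (8 : ℝ) ≤ b := ha8.trans (by exact_mod_cast hab)
  have hba6 : 3 * (b : ℝ) / a ≤ 6 := by
    rw [div_le_iff₀ (by linarith)]
    have : (b : ℝ) ≤ 2 * (X / n₁) := by rw [← mul_div_assoc]; exact hb_le
    linarith
  have hll := loglog_ratio_le (X := X) hb8 hb2X hY4 ha1Y
  have h4t : 1 / (t / 4) = 4 / t := by field_simp
  rw [h4t]
  have hllb0 : 0 ≤ Real.log (Real.log b) / Real.log ((a - 1 : ℕ) : ℝ) := by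
    refine div_nonneg (Real.log_nonneg ?_) (Real.log_nonneg (by linarith))
    rw [← Real.log_exp 1]; refine Real.log_le_log (Real.exp_pos 1) ?_
    have := Real.exp_one_lt_d9; norm_num at this; linarith
  have hB0 : 0 ≤ C_H * Real.exp (-(39 / 40) * ((1 / 4) * (3 / 10 * Real.log (Real.log (Ystar X)) - C_D) + (1 / 2) * Sig S (Ystar X))) +
      C_H * (4 / t + Real.log (Real.log b) / Real.log ((a - 1 : ℕ) : ℝ)) := by positivity
  have hB : C_H * Real.exp (-(39 / 40) * ((1 / 4) * (3 / 10 * Real.log (Real.log (Ystar X)) - C_D) + (1 / 2) * Sig S (Ystar X))) +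
      C_H * (4 / t + Real.log (Real.log b) / Real.log ((a - 1 : ℕ) : ℝ)) ≤
      C_H * Real.exp (-(39 / 40) * ((1 / 4) * (3 / 10 * Real.log (Real.log (Ystar X)) - C_D) + (1 / 2) * Sig S (Ystar X))) +
        C_H * (4 / t + Real.log (Real.log (2 * X)) / Real.log (Ystar X)) := by
    have := mul_le_mul_of_nonneg_left hll hC_H
    linarith
  calc 3 * (b : ℝ) / a * (C_H * Real.exp (-(39 / 40) * ((1 / 4) * (3 / 10 * Real.log (Real.log (Ystar X)) - C_D) + (1 / 2) * Sig S (Ystar X))) +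
        C_H * (4 / t + Real.log (Real.log b) / Real.log ((a - 1 : ℕ) : ℝ)))
      ≤ 6 * (C_H * Real.exp (-(39 / 40) * ((1 / 4) * (3 / 10 * Real.log (Real.log (Ystar X)) - C_D) + (1 / 2) * Sig S (Ystar X))) +
        C_H * (4 / t + Real.log (Real.log b) / Real.log ((a - 1 : ℕ) : ℝ))) :=
        mul_le_mul_of_nonneg_right hba6 hB0
    _ ≤ _ := mul_le_mul_of_nonneg_left hB (by norm_num)

/-- **The first part of `R(1+it)`**: for `X` large and `4 ≤ t ≤ X^A`,
`‖∑_{X ≤ n ≤ 2X, s_S(n) ≤ X^{3/4}} F(n)‖ ≤ e^{Σ_S + C₀} · 6 (C_H e^{-(39/40) M₀'} + C_H (4/t + log log 2X/log Y_*))`.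
[cite: MatomakiRadziwillAnnals2016, Lemma 3 (proof, first term)] -/
theorem first_part_le' {C_H : ℝ} (hC_H : 0 ≤ C_H)
    (hH : ∀ g : ArithmeticFunction ℂ, g.IsMultiplicative → (∀ n, ‖g n‖ ≤ 1) →
      ∀ x T M₀ : ℝ, 3 ≤ x → 1 ≤ T → (∀ y : ℝ, |y| ≤ 2 * T → M₀ ≤ Msum g x y) →
        ‖∑ n ∈ Icc 1 ⌊x⌋₊, g n‖ ≤
          x * (C_H * Real.exp (-(39 / 40) * M₀) + C_H * (1 / T + Real.log (Real.log x) / Real.log x)))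
    {A' x₀ C_D : ℝ}
    (hD : ∀ x : ℝ, x₀ ≤ x → ∀ τ : ℝ, 2 ≤ |τ| → |τ| ≤ x ^ A' →
      3 / 10 * Real.log (Real.log x) - C_D ≤ pretentiousDistSq 1 (fun n : ℕ => (n : ℂ) ^ ((τ : ℂ) * I)) x)
    {f : ArithmeticFunction ℝ} (hf : f.IsMultiplicative) (hf1 : ∀ n, |f n| ≤ 1)
    {P Q X t A : ℝ} (hX1 : 1 ≤ X) (hYx₀ : x₀ ≤ Ystar X) (hY4 : 4 ≤ Ystar X)
    (hXA : 3 * X ^ A ≤ (Ystar X) ^ A') (ht4 : 4 ≤ t) (htA : t ≤ X ^ A) (ht0A : 0 ≤ A) :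
    ‖∑ n ∈ (Finset.Icc ⌈X⌉₊ ⌊2 * X⌋₊).filter (fun n => sPart (primesPQ P Q) n ≤ ⌊X ^ (3 / 4 : ℝ)⌋₊),
        summandR f P Q t n‖ ≤
      Real.exp (SigAll (primesPQ P Q) + RankinComposed.C₀) *
        (6 * (C_H * Real.exp (-(39 / 40) * ((1 / 4) * (3 / 10 * Real.log (Real.log (Ystar X)) - C_D) + (1 / 2) * Sig (primesPQ P Q) (Ystar X))) +
          C_H * (4 / t + Real.log (Real.log (2 * X)) / Real.log (Ystar X)))) := by
  set S := primesPQ P Q with hSdef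
  have hS : ∀ p ∈ S, p.Prime := primesPQ_prime
  have hL : 1 ≤ ⌈X⌉₊ := Nat.one_le_iff_ne_zero.2 (Nat.ceil_pos.2 (by linarith)).ne'
  have h1 := norm_sum_small_sPart_le hf hf1 P Q t (L := ⌈X⌉₊) (U := ⌊2 * X⌋₊) (Zn := ⌊X ^ (3 / 4 : ℝ)⌋₊) hL
  rw [← hSdef] at h1
  refine h1.trans ?_
  set Bnd := 6 * (C_H * Real.exp (-(39 / 40) * ((1 / 4) * (3 / 10 * Real.log (Real.log (Ystar X)) - C_D) + (1 / 2) * Sig S (Ystar X))) +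
    C_H * (4 / t + Real.log (Real.log (2 * X)) / Real.log (Ystar X))) with hBnd
  have hfib : ∀ n₁ ∈ (Finset.Icc 1 ⌊X ^ (3 / 4 : ℝ)⌋₊).filter (· ∈ Nat.factoredNumbers S),
      (1 : ℝ) / n₁ * ‖∑ m ∈ Finset.Icc ((⌈X⌉₊ + n₁ - 1) / n₁) (⌊2 * X⌋₊ / n₁), siftedTwist f S t m / m‖ ≤
        (1 : ℝ) / n₁ * Bnd := by
    intro n₁ hn₁
    rw [Finset.mem_filter, Finset.mem_Icc] at hn₁
    refine mul_le_mul_of_nonneg_left ?_ (by positivity)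
    have hn₁Z : (n₁ : ℝ) ≤ X ^ (3 / 4 : ℝ) :=
      (Nat.cast_le.2 hn₁.1.2).trans (Nat.floor_le (by positivity))
    exact fibre_bound' hC_H hH hD hf hf1 hX1 hYx₀ hY4 hXA ht4 htA ht0A hn₁.1.1 hn₁Z
  calc ∑ n₁ ∈ (Finset.Icc 1 ⌊X ^ (3 / 4 : ℝ)⌋₊).filter (· ∈ Nat.factoredNumbers S),
        (1 : ℝ) / n₁ * ‖∑ m ∈ Finset.Icc ((⌈X⌉₊ + n₁ - 1) / n₁) (⌊2 * X⌋₊ / n₁), siftedTwist f S t m / m‖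
      ≤ ∑ n₁ ∈ (Finset.Icc 1 ⌊X ^ (3 / 4 : ℝ)⌋₊).filter (· ∈ Nat.factoredNumbers S), (1 : ℝ) / n₁ * Bnd :=
        Finset.sum_le_sum hfib
    _ = (∑ n₁ ∈ (Finset.Icc 1 ⌊X ^ (3 / 4 : ℝ)⌋₊).filter (· ∈ Nat.factoredNumbers S), (1 : ℝ) / n₁) * Bnd := by
        rw [Finset.sum_mul]
    _ ≤ Real.exp (SigAll S + RankinComposed.C₀) * Bnd := by
        refine mul_le_mul_of_nonneg_right (sum_inv_factored_le hS _) ?_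
        -- `Bnd ≥ 0`
        have hY : (1 : ℝ) < Ystar X := by linarith
        have : 0 ≤ Real.log (Real.log (2 * X)) / Real.log (Ystar X) := by
          refine div_nonneg (Real.log_nonneg ?_) (Real.log_nonneg hY.le)
          have hX8 : (8 : ℝ) ≤ X := by
            have hYdef : Ystar X = X ^ (1 / 4 : ℝ) / 2 := rfl
            have h14 : X ^ (1 / 4 : ℝ) ≤ X := by
              calc X ^ (1 / 4 : ℝ) ≤ X ^ (1 : ℝ) := Real.rpow_le_rpow_of_exponent_le hX1 (by norm_num)
                _ = X := Real.rpow_one X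
            rw [hYdef] at hY4; linarith
          rw [← Real.log_exp 1]; refine Real.log_le_log (Real.exp_pos 1) ?_
          have := Real.exp_one_lt_d9; norm_num at this; linarith
        positivity


/-- **Term A** (the Halász saving) with the coefficient `3/10`: with `y = log Y_* ≥ ℓ/5`, since
`(39/160)·(3/10) = 117/1600 ≥ 1/16`, `e^{s + C₀} · 6 C_H e^{-(39/40) M₀'} ≤ 30 C_H e^{C₀ + 2C_M + (39/80)(log 5 + C_M) + (39/160)|C_D|} · r · e^{-(log ℓ)/16}`. [folklore] -/
theorem termA_le' {C_H C_D C_M C0 s sst y ℓ r : ℝ} (hC_H : 0 ≤ C_H) (hCM : 0 ≤ C_M) (hℓ : 1 ≤ ℓ)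
    (hy : ℓ / 5 ≤ y) (hr : 1 ≤ r) (hs : Real.exp s ≤ Real.exp C_M * r) (htail : s - sst ≤ Real.log 5 + C_M) :
    Real.exp (s + C0) * (6 * (C_H * Real.exp (-(39 / 40) * ((1 / 4) * (3 / 10 * Real.log y - C_D) + (1 / 2) * sst)))) ≤
      30 * C_H * Real.exp (C0 + 2 * C_M + (39 / 80) * (Real.log 5 + C_M) + (39 / 160) * |C_D|) * r *
        Real.exp (-(Real.log ℓ / 16)) := by
  have hy0 : 0 < y := by linarith
  have hℓ0 : 0 < ℓ := by linarith
  have hlogℓ : 0 ≤ Real.log ℓ := Real.log_nonneg hℓ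
  have hlog5 : 0 ≤ Real.log 5 := Real.log_nonneg (by norm_num)
  have hlogy : Real.log ℓ - Real.log 5 ≤ Real.log y := by
    rw [← Real.log_div hℓ0.ne' (by norm_num)]; exact Real.log_le_log (by positivity) hy
  -- combine the exponentials
  have hCD : C_D ≤ |C_D| := le_abs_self _
  have hE' : s + C0 + -(39 / 40) * ((1 / 4) * (3 / 10 * Real.log y - C_D) + (1 / 2) * sst) ≤
      (41 / 80) * s + (C0 + C_M + (39 / 80) * (Real.log 5 + C_M) + (39 / 160) * |C_D|) +
        (Real.log 5 + -(Real.log ℓ / 16)) := by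
    linarith
  have hE : Real.exp (s + C0) * Real.exp (-(39 / 40) * ((1 / 4) * (3 / 10 * Real.log y - C_D) + (1 / 2) * sst)) ≤
      Real.exp ((41 / 80) * s) * Real.exp (C0 + C_M + (39 / 80) * (Real.log 5 + C_M) + (39 / 160) * |C_D|) *
        (5 * Real.exp (-(Real.log ℓ / 16))) := by
    calc Real.exp (s + C0) * Real.exp (-(39 / 40) * ((1 / 4) * (3 / 10 * Real.log y - C_D) + (1 / 2) * sst))
        = Real.exp (s + C0 + -(39 / 40) * ((1 / 4) * (3 / 10 * Real.log y - C_D) + (1 / 2) * sst)) := by rw [← Real.exp_add]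
      _ ≤ Real.exp ((41 / 80) * s + (C0 + C_M + (39 / 80) * (Real.log 5 + C_M) + (39 / 160) * |C_D|) +
          (Real.log 5 + -(Real.log ℓ / 16))) := Real.exp_le_exp.2 hE'
      _ = _ := by
          have e5 : Real.exp (Real.log 5 + -(Real.log ℓ / 16)) = 5 * Real.exp (-(Real.log ℓ / 16)) := by
            rw [Real.exp_add, Real.exp_log (by norm_num)]
          rw [← e5, ← Real.exp_add, ← Real.exp_add]
  have h5 : Real.exp ((41 / 80) * s) ≤ Real.exp C_M * r := exp_frac_le hCM hr hs
  have hK0 : 0 ≤ Real.exp (C0 + C_M + (39 / 80) * (Real.log 5 + C_M) + (39 / 160) * |C_D|) *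
      (5 * Real.exp (-(Real.log ℓ / 16))) := by positivity
  calc Real.exp (s + C0) * (6 * (C_H * Real.exp (-(39 / 40) * ((1 / 4) * (3 / 10 * Real.log y - C_D) + (1 / 2) * sst))))
      = 6 * C_H * (Real.exp (s + C0) * Real.exp (-(39 / 40) * ((1 / 4) * (3 / 10 * Real.log y - C_D) + (1 / 2) * sst))) := by ring
    _ ≤ 6 * C_H * (Real.exp ((41 / 80) * s) * Real.exp (C0 + C_M + (39 / 80) * (Real.log 5 + C_M) + (39 / 160) * |C_D|) *
        (5 * Real.exp (-(Real.log ℓ / 16)))) := mul_le_mul_of_nonneg_left hE (by positivity)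
    _ ≤ 6 * C_H * ((Real.exp C_M * r) * Real.exp (C0 + C_M + (39 / 80) * (Real.log 5 + C_M) + (39 / 160) * |C_D|) *
        (5 * Real.exp (-(Real.log ℓ / 16)))) := by
        refine mul_le_mul_of_nonneg_left ?_ (by positivity)
        rw [mul_assoc, mul_assoc]
        exact mul_le_mul_of_nonneg_right h5 hK0
    _ = 30 * C_H * (Real.exp C_M * Real.exp (C0 + C_M + (39 / 80) * (Real.log 5 + C_M) + (39 / 160) * |C_D|)) * r *
        Real.exp (-(Real.log ℓ / 16)) := by ring
    _ = _ := by rw [← Real.exp_add]; ring_nf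

/-- **The first part, numerically**: for `log X ≥ 4¹⁶`, `x₀ ≤ Y_*`, `3X^A ≤ Y_*^{A'}`,
`(log X)^{1/16} ≤ t ≤ X^A`: `‖∑_{s_S(n) ≤ X^{3/4}} F(n)‖ ≤ K₁ T₁` with
`K₁ = 30 C_H e^{C₀ + 2C_M + (39/80)(log 5 + C_M) + (39/160)|C_D|} + 114 C_H e^{C₀ + C_M}`. [folklore] -/
theorem first_part_numeric' {C_H : ℝ} (hC_H : 0 ≤ C_H)
    (hH : ∀ g : ArithmeticFunction ℂ, g.IsMultiplicative → (∀ n, ‖g n‖ ≤ 1) →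
      ∀ x T M₀ : ℝ, 3 ≤ x → 1 ≤ T → (∀ y : ℝ, |y| ≤ 2 * T → M₀ ≤ Msum g x y) →
        ‖∑ n ∈ Icc 1 ⌊x⌋₊, g n‖ ≤
          x * (C_H * Real.exp (-(39 / 40) * M₀) + C_H * (1 / T + Real.log (Real.log x) / Real.log x)))
    {A' x₀ C_D : ℝ}
    (hD : ∀ x : ℝ, x₀ ≤ x → ∀ τ : ℝ, 2 ≤ |τ| → |τ| ≤ x ^ A' →
      3 / 10 * Real.log (Real.log x) - C_D ≤ pretentiousDistSq 1 (fun n : ℕ => (n : ℂ) ^ ((τ : ℂ) * I)) x)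
    {C_M : ℝ}
    (hCM : ∀ P Q : ℕ, 2 ≤ P → P ≤ Q → |∑ p ∈ (Finset.Icc P Q).filter Nat.Prime, (1 : ℝ) / p
        - (Real.log (Real.log Q) - Real.log (Real.log P))| ≤ C_M)
    {f : ArithmeticFunction ℝ} (hf : f.IsMultiplicative) (hf1 : ∀ n, |f n| ≤ 1)
    {P Q X t A : ℝ} (hP : 2 ≤ P) (hPQ : P ≤ Q) (hQX : Q ≤ X) (hlogX : (4 : ℝ) ^ 16 ≤ Real.log X)
    (hYx₀ : x₀ ≤ Ystar X) (hXA : 3 * X ^ A ≤ (Ystar X) ^ A')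
    (ht : Real.log X ^ (1 / 16 : ℝ) ≤ t) (htA : t ≤ X ^ A) (ht0A : 0 ≤ A) :
    ‖∑ n ∈ (Finset.Icc ⌈X⌉₊ ⌊2 * X⌋₊).filter (fun n => sPart (primesPQ P Q) n ≤ ⌊X ^ (3 / 4 : ℝ)⌋₊),
        summandR f P Q t n‖ ≤
      (30 * C_H * Real.exp (RankinComposed.C₀ + 2 * C_M + (39 / 80) * (Real.log 5 + C_M) + (39 / 160) * |C_D|) +
        114 * C_H * Real.exp (RankinComposed.C₀ + C_M)) * T1 X P Q := by
  have hCM0 : 0 ≤ C_M := le_trans (abs_nonneg _) (hCM 2 2 le_rfl le_rfl)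
  have h416 : (4 : ℝ) ^ 16 = 4294967296 := by norm_num
  set ℓ := Real.log X with hℓ
  have hℓ1 : 1 ≤ ℓ := by linarith
  have hℓ0 : 0 < ℓ := by linarith
  have hX1 : 1 < X := by
    by_contra h; push Not at h
    have : Real.log X ≤ 0 := Real.log_nonpos (by linarith [hP, hPQ, hQX]) h
    linarith
  have hX0 : 0 < X := by linarith
  have hXexp : X = Real.exp ℓ := by rw [hℓ, Real.exp_log hX0]
  -- `log Y_* = ℓ/4 − log 2 ≥ ℓ/5`, `Y_* ≥ 4`
  have hlog2 : Real.log 2 < 1 := by have := Real.log_two_lt_d9; linarith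
  have hYdef : Ystar X = X ^ (1 / 4 : ℝ) / 2 := rfl
  have hlogY : Real.log (Ystar X) = ℓ / 4 - Real.log 2 := by
    rw [hYdef, Real.log_div (by positivity) (by norm_num), Real.log_rpow hX0]; ring
  have hy : ℓ / 5 ≤ Real.log (Ystar X) := by rw [hlogY]; linarith
  have hY4 : 4 ≤ Ystar X := by
    have h1 : Real.log 4 ≤ Real.log (Ystar X) := by
      rw [hlogY, show (4:ℝ) = 2 ^ 2 by norm_num, Real.log_pow]; push_cast; linarith
    exact (Real.log_le_log_iff (by norm_num) (by rw [hYdef]; positivity)).1 h1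
  have hYX : Ystar X ≤ X := by
    rw [hYdef]
    have : X ^ (1 / 4 : ℝ) ≤ X := by
      calc X ^ (1 / 4 : ℝ) ≤ X ^ (1 : ℝ) := Real.rpow_le_rpow_of_exponent_le hX1.le (by norm_num)
        _ = X := Real.rpow_one X
    linarith [Real.rpow_nonneg hX0.le (1 / 4 : ℝ)]
  -- `t ≥ 4`
  have ht4 : 4 ≤ t := by
    refine le_trans ?_ ht
    have e : ((4 : ℝ) ^ (16 : ℕ)) ^ (1 / 16 : ℝ) = 4 := by
      rw [show (1 / 16 : ℝ) = ((16 : ℕ) : ℝ)⁻¹ by norm_num]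
      exact Real.pow_rpow_inv_natCast (by norm_num) (by norm_num)
    calc (4 : ℝ) = ((4 : ℝ) ^ (16 : ℕ)) ^ (1 / 16 : ℝ) := e.symm
      _ ≤ ℓ ^ (1 / 16 : ℝ) := Real.rpow_le_rpow (by positivity) (by exact_mod_cast hlogX) (by norm_num)
  have hfirst := first_part_le' hC_H hH hD hf hf1 (P := P) (Q := Q) hX1.le hYx₀ hY4 hXA ht4 htA ht0A
  refine hfirst.trans ?_
  -- the ingredients of the three terms
  set S := primesPQ P Q with hSdef
  have hlogP : 0 < Real.log P := Real.log_pos (by linarith)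
  have hr : 1 ≤ Real.log Q / Real.log P := by
    rw [le_div_iff₀ hlogP, one_mul]; exact Real.log_le_log (by linarith) hPQ
  have hs := exp_SigAll_le hCM hP hPQ
  have htail : SigAll S - Sig S (Ystar X) ≤ Real.log 5 + C_M := by
    have h1 := SigAll_sub_Sig_le' hCM (P := P) (Q := Q) (Y := Ystar X) (by linarith)
    have hmax : Real.log (Real.log (max Q (Ystar X))) ≤ Real.log ℓ := by
      have hm : max Q (Ystar X) ≤ X := max_le hQX hYX
      have hm2 : (2 : ℝ) ≤ max Q (Ystar X) := le_trans (hP.trans hPQ) (le_max_left _ _)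
      exact Real.log_le_log (Real.log_pos (by linarith)) (Real.log_le_log (by linarith) hm)
    have hmin : Real.log ℓ - Real.log 5 ≤ Real.log (Real.log (Ystar X)) := by
      rw [← Real.log_div hℓ0.ne' (by norm_num)]
      exact Real.log_le_log (by positivity) hy
    linarith
  have htexp : Real.exp (Real.log ℓ / 16) ≤ t := by
    have : Real.exp (Real.log ℓ / 16) = ℓ ^ (1 / 16 : ℝ) := by rw [Real.rpow_def_of_pos hℓ0]; ring_nf
    rw [this]; exact ht
  have hL0 : 0 ≤ Real.log (Real.log (2 * X)) := by
    refine Real.log_nonneg ?_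
    rw [Real.log_mul (by norm_num) hX0.ne']; linarith [Real.log_pos one_lt_two]
  have hL : Real.log (Real.log (2 * X)) ≤ 3 * Real.exp (Real.log ℓ / 2) := by
    have h := loglog_two_mul_le hX1.le hℓ1
    have e : ℓ ^ (1 / 2 : ℝ) = Real.exp (Real.log ℓ / 2) := by rw [Real.rpow_def_of_pos hℓ0]; ring_nf
    rw [← e]; exact h
  have hA := termA_le' (C0 := RankinComposed.C₀) (C_D := C_D) hC_H hCM0 hℓ1 hy hr hs htail
  have hB := termB_le (C0 := RankinComposed.C₀) (C_M := C_M) hC_H hr hs htexp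
  have hC := termC_le (C0 := RankinComposed.C₀) (C_M := C_M) hC_H hℓ1 hy hr hs hL0 hL
  have hT1 : Real.log Q / Real.log P * Real.exp (-(Real.log ℓ / 16)) = T1 X P Q := by
    rw [hℓ]; exact r_exp_eq (by rw [← hℓ]; exact hℓ0) hlogP
  -- distribute and add
  have e : Real.exp (SigAll S + RankinComposed.C₀) *
      (6 * (C_H * Real.exp (-(39 / 40) * ((1 / 4) * (3 / 10 * Real.log (Real.log (Ystar X)) - C_D) + (1 / 2) * Sig S (Ystar X))) +
        C_H * (4 / t + Real.log (Real.log (2 * X)) / Real.log (Ystar X))))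
      = Real.exp (SigAll S + RankinComposed.C₀) *
          (6 * (C_H * Real.exp (-(39 / 40) * ((1 / 4) * (3 / 10 * Real.log (Real.log (Ystar X)) - C_D) + (1 / 2) * Sig S (Ystar X)))))
        + Real.exp (SigAll S + RankinComposed.C₀) * (6 * (C_H * (4 / t)))
        + Real.exp (SigAll S + RankinComposed.C₀) * (6 * (C_H * (Real.log (Real.log (2 * X)) / Real.log (Ystar X)))) := by
    ring
  rw [e, ← hT1]
  have hT1pos : 0 ≤ Real.log Q / Real.log P * Real.exp (-(Real.log ℓ / 16)) := by positivity
  nlinarith [hA, hB, hC, hT1pos, Real.exp_pos (RankinComposed.C₀ + C_M),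
    Real.exp_pos (RankinComposed.C₀ + 2 * C_M + (39 / 80) * (Real.log 5 + C_M) + (39 / 160) * |C_D|)]

end MatomakiRadziwillL3VK

open MatomakiRadziwillL3 MatomakiRadziwillL3VK in
/-- **Matomäki–Radziwiłł 2016, Lemma 3 — from Granville–Soundararajan's Theorem 1 and the Vinogradov–Korobov
prime tail at `θ = 7/10`** (the conclusion of `TwistedPrimeSumTail.pretentiousDistSq_one_twist_tail_ge`).  For every `A > 0` there is `C` such that for every real multiplicative `f` with
`|f| ≤ 1` and all `2 ≤ P ≤ Q ≤ X`, `(log X)^{1/16} ≤ t ≤ X^A`,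
`|R(1+it)| ≤ C (log Q/((log X)^{1/16} log P) + log X · exp(−(log X/(3 log Q)) log(log X/log Q)))`,
`R(s) = ∑_{X ≤ n ≤ 2X} f(n) n^{-s}/(#{p ∈ [P,Q] : p ∣ n} + 1)`.
Proof (the printed one, MR §2): split `n = n₁ n₂` by the `S = 𝒫 ∩ [P,Q]`-part `n₁ = s_S(n)`; for
`n₁ ≤ X^{3/4}` apply Halász in the form of MR's Lemma 1 (`MatomakiRadziwillL3.halasz_of_GS`, from
`GranvilleSoundararajan2003_theorem1`) to the sifted twist `G = f 1_{(n,∏S)=1} n^{-it}` on each fibre, its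
distance being `≥ ¼ 𝔻(1, n^{2i(t+y)})² + ½ ∑_{p ∈ S, p ≤ y} 1/p` (`Msum_siftedTwist_ge`) with MR Lemma 2 in the
form `𝔻² ≥ (3/10) log log − C` (`pretentiousDistSq_one_twist_ge_of_tail`) — the sifting gain offsetting
`∑_{n₁} 1/n₁ ≤ ∏_{p ∈ S}(1 − 1/p)⁻¹`; for `n₁ > X^{3/4}` Rankin's trick over `S`-composed numbers
(`RankinComposedTail.lean`) or the trivial bound, according to the size of `u = log X/log Q`.
[cite: MatomakiRadziwillAnnals2016, Lemma 3] -/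
theorem MatomakiRadziwill2016_lemma3_of_GS_tail
    (hGS : Literature.NumberTheory.LFunctions.GranvilleSoundararajan.GranvilleSoundararajan2003_theorem1)
    (hT : ∀ᶠ X : ℝ in atTop, ∀ t : ℝ, 1 ≤ |t| → |t| ≤ X → ∀ Y : ℝ,
      Real.exp (Real.log X ^ (7 / 10 : ℝ)) ≤ Y → Y ≤ X →
        Real.log (Real.log Y) - 7 / 10 * Real.log (Real.log X) - 6 ≤
          pretentiousDistSq 1 (fun n : ℕ => (n : ℂ) ^ ((t : ℂ) * I)) Y -
            pretentiousDistSq 1 (fun n : ℕ => (n : ℂ) ^ ((t : ℂ) * I)) (Real.exp (Real.log X ^ (7 / 10 : ℝ)) - 1)) :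
    MatomakiRadziwill2016_lemma3 := by
  intro A hA
  obtain ⟨C_H, hC_H, hH⟩ := halasz_of_GS hGS
  obtain ⟨x₀, C_D, hx₀, hD⟩ := pretentiousDistSq_one_twist_ge_of_tail hT (4 * A + 8)
  obtain ⟨C_M, hCM⟩ := RankinComposed.exists_abs_sum_inv_primes_Icc_sub_le
  set K₁ : ℝ := 30 * C_H * Real.exp (RankinComposed.C₀ + 2 * C_M + (39 / 80) * (Real.log 5 + C_M) + (39 / 160) * |C_D|) +
    114 * C_H * Real.exp (RankinComposed.C₀ + C_M) with hK₁
  set K₂ : ℝ := 2 + 6 * Real.exp (C_M + 3 + RankinComposed.C₀ + 24 * Real.exp 288) +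
    (400 / 3) * Real.exp (Real.exp 400 + RankinComposed.C₀) + 450 * Real.exp RankinComposed.C₀ with hK₂
  set X₀ : ℝ := max (Real.exp ((4 : ℝ) ^ 16)) (max ((2 * x₀) ^ 4) (3 * (2 : ℝ) ^ (4 * A + 8))) with hX₀
  have hK₁0 : 0 ≤ K₁ := by positivity
  have hK₂0 : 0 ≤ K₂ := by positivity
  have hX₀1 : Real.exp ((4:ℝ) ^ 16) ≤ X₀ := le_max_left _ _
  have hlogX₀ : (1 : ℝ) ≤ Real.log X₀ := by
    have := Real.log_le_log (Real.exp_pos _) hX₀1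
    rw [Real.log_exp] at this
    have : (1:ℝ) ≤ 4 ^ 16 := by norm_num
    linarith
  refine ⟨2 * Real.log X₀ ^ (1 / 16 : ℝ) + K₁ + K₂, ?_⟩
  intro f hf hf1 X P Q t hP hPQ hQX ht htA
  show ‖∑ n ∈ Finset.Icc ⌈X⌉₊ ⌊2 * X⌋₊, summandR f P Q t n‖ ≤
    (2 * Real.log X₀ ^ (1 / 16 : ℝ) + K₁ + K₂) * (T1 X P Q + T2 X Q)
  have hX2 : 2 ≤ X := (hP.trans hPQ).trans hQX
  have hlogX : 0 < Real.log X := Real.log_pos (by linarith)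
  have hT1 := inv_rpow_le_T1 hP hPQ hlogX
  have hT1pos : 0 < T1 X P Q := lt_of_lt_of_le (by positivity) hT1
  have hT2 : 0 ≤ T2 X Q := by unfold T2; positivity
  by_cases hlarge : X₀ ≤ X
  · obtain ⟨hℓ, hYx₀, hXA⟩ := threshold (by linarith) (hX₀ ▸ hlarge)
    have hℓ1 : 1 ≤ Real.log X := le_trans (by norm_num) hℓ
    rw [sum_split f P Q t X ⌊X ^ (3 / 4 : ℝ)⌋₊]
    refine (norm_add_le _ _).trans ?_
    have h1 := first_part_numeric' hC_H hH hD hCM hf hf1 hP hPQ hQX hℓ hYx₀ hXA ht htA hA.le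
    have h2 := second_part_numeric hCM hf1 hP hPQ hQX hℓ1 (t := t)
    rw [← hK₁] at h1; rw [← hK₂] at h2
    have hL0 : 0 ≤ 2 * Real.log X₀ ^ (1 / 16 : ℝ) := by positivity
    have h5 : K₁ * T1 X P Q + K₂ * (T1 X P Q + T2 X Q) ≤
        (2 * Real.log X₀ ^ (1 / 16 : ℝ) + K₁ + K₂) * (T1 X P Q + T2 X Q) := by
      nlinarith [mul_nonneg hL0 hT1pos.le, mul_nonneg hL0 hT2, mul_nonneg hK₁0 hT2]
    linarith
  · -- small `X`: the trivial bound
    push Not at hlarge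
    have hR : ‖∑ n ∈ Finset.Icc ⌈X⌉₊ ⌊2 * X⌋₊, summandR f P Q t n‖ ≤ 2 := by
      have := norm_sum_filter_summandR_le_two hf1 P Q t (by linarith : (1:ℝ) ≤ X) (fun _ => True)
      simpa using this
    have hmono : Real.log X ^ (1 / 16 : ℝ) ≤ Real.log X₀ ^ (1 / 16 : ℝ) :=
      Real.rpow_le_rpow hlogX.le (Real.log_le_log (by linarith) hlarge.le) (by norm_num)
    have h3 : (2 : ℝ) ≤ 2 * Real.log X₀ ^ (1 / 16 : ℝ) * T1 X P Q := by
      have hpos : 0 < Real.log X ^ (1 / 16 : ℝ) := by positivity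
      have : 1 ≤ Real.log X₀ ^ (1 / 16 : ℝ) * (1 / Real.log X ^ (1 / 16 : ℝ)) := by
        rw [mul_one_div, le_div_iff₀ hpos, one_mul]; exact hmono
      nlinarith [mul_le_mul_of_nonneg_left hT1 (show 0 ≤ Real.log X₀ ^ (1 / 16 : ℝ) by positivity)]
    have h4 : 2 * Real.log X₀ ^ (1 / 16 : ℝ) * T1 X P Q ≤
        (2 * Real.log X₀ ^ (1 / 16 : ℝ) + K₁ + K₂) * (T1 X P Q + T2 X Q) := by
      have hL0 : 0 ≤ 2 * Real.log X₀ ^ (1 / 16 : ℝ) := by positivity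
      nlinarith [mul_nonneg hK₁0 hT1pos.le, mul_nonneg hK₂0 hT1pos.le, mul_nonneg hL0 hT2,
        mul_nonneg hK₁0 hT2, mul_nonneg hK₂0 hT2]
    linarith


open Literature.NumberTheory.LFunctions in
/-- **Matomäki–Radziwiłł 2016, Lemma 3, from Khale's Vinogradov–Korobov zero-free region alone** (the sharp
Halász theorem `GranvilleSoundararajan2003_theorem1_holds` being proved, and the prime tail supplied by
`TwistedPrimeSumTail.pretentiousDistSq_one_twist_tail_ge` at `θ = 7/10`).
[cite: MatomakiRadziwillAnnals2016, Lemma 3] -/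
theorem MatomakiRadziwill2016_lemma3_of_khale (hK : Khale2024_zeroFreeRegion) : MatomakiRadziwill2016_lemma3 :=
  MatomakiRadziwill2016_lemma3_of_GS_tail GranvilleSoundararajan2003_theorem1_holds
    (TwistedPrimeSumTail.pretentiousDistSq_one_twist_tail_ge hK (θ := 7 / 10) (by norm_num))

open Literature.NumberTheory.LFunctions in
/-- **Proposition 1 of Matomäki–Radziwiłł from Khale's Vinogradov–Korobov zero-free region alone**: Lemma 3
(`MatomakiRadziwill2016_lemma3_of_khale`) and Lemma 11 (`MatomakiRadziwill2016_lemma11_of_khale`) plugged into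
the proved §8 assembly `MatomakiRadziwill2016_prop1_of_lemma3_lemma11`; Ford's bound is no longer used.
[cite: MatomakiRadziwillAnnals2016, Proposition 1] -/
theorem MatomakiRadziwill2016_prop1_of_khale (hK : Khale2024_zeroFreeRegion) : MatomakiRadziwill2016_prop1 :=
  MatomakiRadziwill2016_prop1_of_lemma3_lemma11 (MatomakiRadziwill2016_lemma3_of_khale hK)
    (MatomakiRadziwill2016_lemma11_of_khale hK)

open Literature.NumberTheory.LFunctions in
/-- **Theorem 3 of Matomäki–Radziwiłł** from its Lemma 4 and Khale's zero-free region.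
[cite: MatomakiRadziwillAnnals2016, Theorem 3] -/
theorem MatomakiRadziwill2016_theorem3_of_lemma4_khale (h4 : MatomakiRadziwill2016_lemma4)
    (hK : Khale2024_zeroFreeRegion) : MatomakiRadziwill2016_theorem3 :=
  MatomakiRadziwill2016_theorem3_of_prop1_real MatomakiRadziwill2016_lemma14_real_holds h4
    (MatomakiRadziwill2016_prop1_of_khale hK)

open Literature.NumberTheory.LFunctions in
/-- **Theorem 1 of Matomäki–Radziwiłł** (the named fact `MatomakiRadziwill2016_theorem1`) from its Lemma 4 and
Khale's Vinogradov–Korobov zero-free region — the trust base is now `{MatomakiRadziwill2016_lemma4, Khale2024_zeroFreeRegion}`.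
[cite: MatomakiRadziwillAnnals2016, Theorem 1] -/
theorem MatomakiRadziwill2016_theorem1_of_lemma4_khale (h4 : MatomakiRadziwill2016_lemma4)
    (hK : Khale2024_zeroFreeRegion) : MatomakiRadziwill2016_theorem1 :=
  MatomakiRadziwill2016_theorem1_of_theorem3 (MatomakiRadziwill2016_theorem3_of_lemma4_khale h4 hK)

open Literature.NumberTheory.LFunctions in
/-- **parity.S38 (`matomaki_radziwill`)** from Lemma 4 and Khale's region. [cite: MatomakiRadziwillAnnals2016, Theorem 1] -/
theorem matomaki_radziwill_of_lemma4_khale (h4 : MatomakiRadziwill2016_lemma4)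
    (hK : Khale2024_zeroFreeRegion) : matomaki_radziwill :=
  matomaki_radziwill_of_theorem1 (MatomakiRadziwill2016_theorem1_of_lemma4_khale h4 hK)

/-! ### From any Vinogradov–Korobov region (the inexplicit interface `HasVKZeroFreeRegion c T₀`) -/

open Literature.NumberTheory.LFunctions in
/-- **Matomäki–Radziwiłł 2016, Lemma 3, from any Vinogradov–Korobov zero-free region** `HasVKZeroFreeRegion c T₀`
(`c > 0`, any starting height; the inexplicit interface of `VinogradovKorobovDirichlet.lean`): the sharp Halász
theorem `GranvilleSoundararajan2003_theorem1_holds` and the prime tail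
`TwistedPrimeSumTail.pretentiousDistSq_one_twist_tail_ge_of_vk` at `θ = 7/10`.
[cite: MatomakiRadziwillAnnals2016, Lemma 3] -/
theorem MatomakiRadziwill2016_lemma3_of_vk {c T₀ : ℝ} (hc : 0 < c) (hVK : HasVKZeroFreeRegion c T₀) :
    MatomakiRadziwill2016_lemma3 :=
  MatomakiRadziwill2016_lemma3_of_GS_tail GranvilleSoundararajan2003_theorem1_holds
    (TwistedPrimeSumTail.pretentiousDistSq_one_twist_tail_ge_of_vk hc hVK (θ := 7 / 10) (by norm_num))

open Literature.NumberTheory.LFunctions in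
/-- **Proposition 1 of Matomäki–Radziwiłł from any Vinogradov–Korobov zero-free region** `HasVKZeroFreeRegion c T₀`,
`c > 0` — explicit or not: Lemma 3 (`MatomakiRadziwill2016_lemma3_of_vk`) and Lemma 11
(`MatomakiRadziwill2016_lemma11_of_vk`) in the proved §8 assembly `MatomakiRadziwill2016_prop1_of_lemma3_lemma11`.
This is the whole remaining trust base of Proposition 1: any proof of a Vinogradov–Korobov region for Dirichlet
`L`-functions in this interface discharges `MatomakiRadziwill2016_prop1` (Matomäki–Radziwiłł's own argument involves
`ζ` only — Lemma 11 and Lemma 2 are instantiated at level `q = 1` — but the tree's reductions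
`TwistedVonMangoldt.exists_twistData_of_vk` are stated uniformly in `q ≤ (log X)^A` and consume the region as such).
[cite: MatomakiRadziwillAnnals2016, Proposition 1] -/
theorem MatomakiRadziwill2016_prop1_of_vk {c T₀ : ℝ} (hc : 0 < c) (hVK : HasVKZeroFreeRegion c T₀) :
    MatomakiRadziwill2016_prop1 :=
  MatomakiRadziwill2016_prop1_of_lemma3_lemma11 (MatomakiRadziwill2016_lemma3_of_vk hc hVK)
    (MatomakiRadziwill2016_lemma11_of_vk hc hVK)

open Literature.NumberTheory.LFunctions in
/-- **Theorem 3 of Matomäki–Radziwiłł** from its Lemma 4 and any Vinogradov–Korobov region.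
[cite: MatomakiRadziwillAnnals2016, Theorem 3] -/
theorem MatomakiRadziwill2016_theorem3_of_lemma4_vk (h4 : MatomakiRadziwill2016_lemma4) {c T₀ : ℝ} (hc : 0 < c)
    (hVK : HasVKZeroFreeRegion c T₀) : MatomakiRadziwill2016_theorem3 :=
  MatomakiRadziwill2016_theorem3_of_prop1_real MatomakiRadziwill2016_lemma14_real_holds h4
    (MatomakiRadziwill2016_prop1_of_vk hc hVK)

open Literature.NumberTheory.LFunctions in
/-- **Theorem 1 of Matomäki–Radziwiłł** (the named fact `MatomakiRadziwill2016_theorem1`) from its Lemma 4 and any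
Vinogradov–Korobov zero-free region `HasVKZeroFreeRegion c T₀`, `c > 0`.
[cite: MatomakiRadziwillAnnals2016, Theorem 1] -/
theorem MatomakiRadziwill2016_theorem1_of_lemma4_vk (h4 : MatomakiRadziwill2016_lemma4) {c T₀ : ℝ} (hc : 0 < c)
    (hVK : HasVKZeroFreeRegion c T₀) : MatomakiRadziwill2016_theorem1 :=
  MatomakiRadziwill2016_theorem1_of_theorem3 (MatomakiRadziwill2016_theorem3_of_lemma4_vk h4 hc hVK)

open Literature.NumberTheory.LFunctions in
/-- **parity.S38 (`matomaki_radziwill`)** from Lemma 4 and any Vinogradov–Korobov region.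
[cite: MatomakiRadziwillAnnals2016, Theorem 1] -/
theorem matomaki_radziwill_of_lemma4_vk (h4 : MatomakiRadziwill2016_lemma4) {c T₀ : ℝ} (hc : 0 < c)
    (hVK : HasVKZeroFreeRegion c T₀) : matomaki_radziwill :=
  matomaki_radziwill_of_theorem1 (MatomakiRadziwill2016_theorem1_of_lemma4_vk h4 hc hVK)

open Literature.NumberTheory.LFunctions in
/-- **Proposition 1 of Matomäki–Radziwiłł from Richert-type bounds** for `ζ` and for the `L(s, χ)` of
non-principal characters (`RichertBound A B`, `RichertBoundL A B`: `|ζ(σ + it)| ≤ A|t|^{B(1−σ)^{3/2}}(log|t|)^{2/3}`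
etc., ANY constants `A, B` — the output shape of Vinogradov's method), through the tree's Landau–Titchmarsh deduction
`hasVKZeroFreeRegion_of_richert` (`VinogradovKorobovFromRichert.lean`) and `MatomakiRadziwill2016_prop1_of_vk`.
[cite: MatomakiRadziwillAnnals2016, Proposition 1] -/
theorem MatomakiRadziwill2016_prop1_of_richert {A B : ℝ} (hRζ : RichertBound A B) (hRL : RichertBoundL A B) :
    MatomakiRadziwill2016_prop1 := by
  obtain ⟨c, hc, hVK⟩ := hasVKZeroFreeRegion_of_richert hRζ hRL
  exact MatomakiRadziwill2016_prop1_of_vk hc hVK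

open Literature.NumberTheory.LFunctions in
/-- **Theorem 1 of Matomäki–Radziwiłł** from its Lemma 4 and Richert-type bounds for `ζ` and `L(s, χ)` (any
constants). [cite: MatomakiRadziwillAnnals2016, Theorem 1] -/
theorem MatomakiRadziwill2016_theorem1_of_lemma4_richert (h4 : MatomakiRadziwill2016_lemma4) {A B : ℝ}
    (hRζ : RichertBound A B) (hRL : RichertBoundL A B) : MatomakiRadziwill2016_theorem1 := by
  obtain ⟨c, hc, hVK⟩ := hasVKZeroFreeRegion_of_richert hRζ hRL
  exact MatomakiRadziwill2016_theorem1_of_lemma4_vk h4 hc hVK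

end Literature.NumberTheory.Sieve
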